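import Literature.ModelTheory.ExponentialFields.CylindricalDecompositionProofs
import Literature.NumberTheory.Transcendental.KZLogCalculusProofs

/-!
# `BetaCancellation` (stmt-KontsevichZagierPeriods-13633), line `divisor-slicing-transshipment`:
# stub `stub_pencilSheets` — auxiliary file (sheets of a thin semialgebraic set, fat levels)

Two inputs of the pencil-sheet structure theorem `stub_pencilSheets`, both for `ℚ`-semialgebraic
sets with the sliced coordinate LAST (`Fin.snoc`/`Fin.init`, the convention of the tree's
cylindrical decomposition `Literature.ModelTheory.ExponentialFields.IsCylindricalDecomposition`):

* `exists_sheets_of_interior_eq_empty` — a `ℚ`-semialgebraic `σ ⊆ ℝ^{d+1}` with EMPTY INTERIOR is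
  covered, over Lebesgue-a.e. `a ∈ ℝ^d`, by finitely many `ℚ`-semialgebraic sheets `t = θ_i(a)`
  over `ℚ`-semialgebraic pieces `U_i ⊆ ℝ^d`, pairwise distinct on overlaps. Proof: take the
  cylindrical decomposition adapted to `σ`
  (`IsSemialgebraic.exists_cylindricalDecomposition.exists_fibre_eq`, PROVED in the tree by
  `IsSemialgebraic.exists_cylindricalDecomposition_holds`); the sheets are the graph cells of `σ`;
  a base cell carrying a band cell of `σ` is Lebesgue-null, for otherwise it has non-empty
  interior (`KZ.volume_eq_zero_of_interior_eq_empty`) and the band over that interior is a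
  non-empty open subset of `σ`.
* `finite_setOf_fat_level` — for a `ℚ`-semialgebraic `W ⊆ ℝ^{n+1}` whose horizontal slices
  `W_τ = {w | (w, τ) ∈ W}` are pairwise disjoint, only FINITELY many slices have non-empty
  interior: the set `T` of such `τ` is countable (disjoint sets with non-empty interior in a
  separable space) and `ℚ`-semialgebraic (two Tarski–Seidenberg projections,
  `tarski_seidenberg_real_holds`), hence has empty interior in `ℝ`, hence lies in finitely many
  zero sets of non-zero univariate polynomials (`IsSemialgebraic.subset_interior_union`).

References: S. Basu, R. Pollack, M.-F. Roy, *Algorithms in Real Algebraic Geometry* (2006),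
Cor. 5.7, Thm. 2.76; J. Bochnak, M. Coste, M.-F. Roy, *Real Algebraic Geometry* (1998), §2.2, §2.8.
No definitions are introduced.
-/

noncomputable section

set_option linter.dupNamespace false

open MeasureTheory Set MvPolynomial
open Literature.NumberTheory.Transcendental
open Literature.NumberTheory.Transcendental.KZ
open Literature.ModelTheory.ExponentialFields

namespace Summit.KontsevichZagierPeriods.KontsevichZagierPeriods.BetaCancellationDivisorSlicing

namespace PencilSheets

/-! ## Sheets of a thin semialgebraic set from its cylindrical decomposition -/

/-- The lower boundary `ξ_{j-1}` of the `j`-th band (extended-real valued, `ξ_{-1} = -∞`) is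
continuous on any subset of a set on which the sections are continuous. [folklore] -/
theorem continuousOn_bandLower {n l : ℕ} {S V : Set (Fin n → ℝ)} (ξ : Fin l → (Fin n → ℝ) → ℝ)
    (hcont : ∀ i, ContinuousOn (ξ i) S) (hVS : V ⊆ S) (j : Fin (l + 1)) :
    ContinuousOn (fun x => bandLower ξ j x) V := by
  cases j using Fin.cases with
  | zero =>
    simp only [bandLower_zero]
    exact continuousOn_const
  | succ i =>
    simp only [bandLower_succ]
    exact continuous_coe_real_ereal.comp_continuousOn ((hcont i).mono hVS)

/-- The upper boundary `ξ_j` of the `j`-th band (extended-real valued, `ξ_ℓ = +∞`) is continuous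
on any subset of a set on which the sections are continuous. [folklore] -/
theorem continuousOn_bandUpper {n l : ℕ} {S V : Set (Fin n → ℝ)} (ξ : Fin l → (Fin n → ℝ) → ℝ)
    (hcont : ∀ i, ContinuousOn (ξ i) S) (hVS : V ⊆ S) (j : Fin (l + 1)) :
    ContinuousOn (fun x => bandUpper ξ j x) V := by
  cases j using Fin.lastCases with
  | last =>
    simp only [bandUpper_last]
    exact continuousOn_const
  | cast i =>
    simp only [bandUpper_castSucc]
    exact continuous_coe_real_ereal.comp_continuousOn ((hcont i).mono hVS)

/-- The part of a band lying over an OPEN subset `V` of its base, on which the sections are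
continuous, is open in `ℝⁿ⁺¹`. [folklore] -/
theorem isOpen_band_over {n l : ℕ} {S V : Set (Fin n → ℝ)} (ξ : Fin l → (Fin n → ℝ) → ℝ)
    (hcont : ∀ i, ContinuousOn (ξ i) S) (hVS : V ⊆ S) (hV : IsOpen V) (j : Fin (l + 1)) :
    IsOpen {w : Fin (n + 1) → ℝ | Fin.init w ∈ V ∧ bandLower ξ j (Fin.init w) < (w (Fin.last n) : EReal) ∧
      (w (Fin.last n) : EReal) < bandUpper ξ j (Fin.init w)} := by
  have hinit : Continuous (Fin.init : (Fin (n + 1) → ℝ) → Fin n → ℝ) :=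
    continuous_pi fun i => continuous_apply _
  have hs : IsOpen ((Fin.init : (Fin (n + 1) → ℝ) → Fin n → ℝ) ⁻¹' V) := hV.preimage hinit
  have hmaps : MapsTo (Fin.init : (Fin (n + 1) → ℝ) → Fin n → ℝ) (Fin.init ⁻¹' V) V :=
    fun w hw => hw
  have hlast : Continuous fun w : Fin (n + 1) → ℝ => (w (Fin.last n) : EReal) :=
    continuous_coe_real_ereal.comp (continuous_apply _)
  have h1 : IsOpen ((Fin.init ⁻¹' V) ∩ (fun w : Fin (n + 1) → ℝ =>
      (bandLower ξ j (Fin.init w), (w (Fin.last n) : EReal))) ⁻¹' {p : EReal × EReal | p.1 < p.2}) :=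
    (((continuousOn_bandLower ξ hcont hVS j).comp hinit.continuousOn hmaps).prodMk
      hlast.continuousOn).isOpen_inter_preimage hs isOpen_lt_prod
  have h2 : IsOpen ((Fin.init ⁻¹' V) ∩ (fun w : Fin (n + 1) → ℝ =>
      ((w (Fin.last n) : EReal), bandUpper ξ j (Fin.init w))) ⁻¹' {p : EReal × EReal | p.1 < p.2}) :=
    (hlast.continuousOn.prodMk
      ((continuousOn_bandUpper ξ hcont hVS j).comp hinit.continuousOn hmaps)).isOpen_inter_preimage
      hs isOpen_lt_prod
  convert h1.inter h2 using 1
  ext w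
  simp only [mem_setOf_eq, mem_inter_iff, mem_preimage]
  tauto

/-- In a cylindrical decomposition adapted to a semialgebraic `σ ⊆ ℝᵈ⁺¹` with EMPTY INTERIOR, a
base cell over which some band is contained in `σ` is Lebesgue-null: otherwise the cell has
non-empty interior (`KZ.volume_eq_zero_of_interior_eq_empty`) and the band over this interior is
a non-empty open subset of `σ`. [folklore] -/
theorem volume_base_eq_zero_of_band_subset {d l : ℕ} {σ : Set (Fin (d + 1) → ℝ)}
    (hint : interior σ = ∅) {C : Set (Fin d → ℝ)} (hC : IsSemialgebraic ℚ C)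
    (ξ : Fin l → (Fin d → ℝ) → ℝ) (hcont : ∀ i, ContinuousOn (ξ i) C)
    (hmono : ∀ x ∈ C, StrictMono fun i => ξ i x) (j : Fin (l + 1))
    (hband : bandOver C ξ j ⊆ σ) : volume C = 0 := by
  by_contra hvol
  have hIne : (interior C).Nonempty := by
    by_contra h
    exact hvol (volume_eq_zero_of_interior_eq_empty hC (not_nonempty_iff_eq_empty.mp h))
  obtain ⟨a, ha⟩ := hIne
  obtain ⟨t, ht⟩ := CylindricalDecomposition.exists_mem_band ξ a (hmono a (interior_subset ha)) j
  have hO := isOpen_band_over ξ hcont interior_subset isOpen_interior j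
  have hOσ : {w : Fin (d + 1) → ℝ | Fin.init w ∈ interior C ∧
      bandLower ξ j (Fin.init w) < (w (Fin.last d) : EReal) ∧
      (w (Fin.last d) : EReal) < bandUpper ξ j (Fin.init w)} ⊆ σ :=
    fun w hw => hband ⟨interior_subset hw.1, hw.2.1, hw.2.2⟩
  have hw : (Fin.snoc a t : Fin (d + 1) → ℝ) ∈ interior σ :=
    interior_maximal hOσ hO (by simpa using And.intro ha ht)
  rw [hint] at hw
  exact hw

/-- A function is (vacuously) `ℚ`-semialgebraic on the empty set: its graph there is empty.
[folklore] -/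
theorem isSemialgebraicFunOn_empty {n : ℕ} (f : (Fin n → ℝ) → ℝ) :
    IsSemialgebraicFunOn ℚ (∅ : Set (Fin n → ℝ)) f := by
  rw [isSemialgebraicFunOn_iff]
  convert (isSemialgebraic_empty : IsSemialgebraic ℚ (∅ : Set (Fin (n + 1) → ℝ))) using 1
  ext z
  simp

/-- **Sheets of a thin semialgebraic set.** A `ℚ`-semialgebraic `σ ⊆ ℝᵈ⁺¹` (last coordinate `t`
distinguished) with empty interior is covered, for Lebesgue-a.e. `a ∈ ℝᵈ`, by finitely many
`ℚ`-semialgebraic sheets `t = θ_i(a)` over `ℚ`-semialgebraic pieces `U_i`, the sheets lying in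
`σ` and taking pairwise distinct values on overlaps. The sheets are the graph cells of `σ` in a
cylindrical decomposition adapted to `σ` (Basu–Pollack–Roy 2006, Cor. 5.7, proved in the tree);
the base cells carrying band cells of `σ` are null (`volume_base_eq_zero_of_band_subset`).
[folklore] -/
theorem exists_sheets_of_interior_eq_empty : ∀ {d : ℕ} {σ : Set (Fin (d + 1) → ℝ)}, IsSemialgebraic ℚ σ → interior σ = ∅ → ∃ (m : ℕ) (U : Fin m → Set (Fin d → ℝ)) (θ : Fin m → (Fin d → ℝ) → ℝ), (∀ i, IsSemialgebraic ℚ (U i) ∧ IsSemialgebraicFunOn ℚ (U i) (θ i)) ∧ (∀ i, ∀ a ∈ U i, (Fin.snoc a (θ i a) : Fin (d + 1) → ℝ) ∈ σ) ∧ (∀ i i', i ≠ i' → ∀ a ∈ U i ∩ U i', θ i a ≠ θ i' a) ∧ volume {a : Fin d → ℝ | ∃ t : ℝ, (Fin.snoc a t : Fin (d + 1) → ℝ) ∈ σ ∧ ∀ i, ¬ (a ∈ U i ∧ θ i a = t)} = 0 := by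
  intro d σ hσ hint
  classical
  obtain ⟨𝒮, l, ξ, h𝒮, hcont, hsa, hmono, -, hfib⟩ :=
    IsSemialgebraic.exists_cylindricalDecomposition.exists_fibre_eq
      IsSemialgebraic.exists_cylindricalDecomposition_holds hσ
  choose G B hG hB hfibre using hfib
  have hpart := h𝒮.isPartition
  have huniq : ∀ C ∈ 𝒮, ∀ C' ∈ 𝒮, ∀ a : Fin d → ℝ, a ∈ C → a ∈ C' → C = C' := by
    intro C hC C' hC' a ha ha'
    obtain ⟨D, -, hD⟩ := hpart.2 a
    exact (hD C ⟨hC, ha⟩).trans (hD C' ⟨hC', ha'⟩).symm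
  have hnull : ∀ C (hC : C ∈ 𝒮), (B C hC).Nonempty → volume C = 0 := fun C hC ⟨j, hj⟩ =>
    volume_base_eq_zero_of_band_subset hint (h𝒮.isSemialgebraic C hC) (ξ C) (hcont C hC)
      (hmono C hC) j (hB C hC j hj)
  -- the sheets: graph cells of `σ`, indexed by `(C, j)`, `C ∈ 𝒮`, `j < l C` (empty piece if the
  -- `j`-th graph over `C` is not a cell of `σ`)
  let I := Σ C : 𝒮, Fin (l C)
  let cell : I → Set (Fin d → ℝ) := fun x => if x.2 ∈ G x.1 x.1.2 then (x.1 : Set (Fin d → ℝ)) else ∅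
  let val : I → (Fin d → ℝ) → ℝ := fun x => ξ x.1 x.2
  have hcell : ∀ x : I, ∀ a, a ∈ cell x → x.2 ∈ G x.1 x.1.2 ∧ a ∈ (x.1 : Set (Fin d → ℝ)) := by
    intro x a ha
    by_cases hx : x.2 ∈ G x.1 x.1.2
    · simp only [cell, if_pos hx] at ha
      exact ⟨hx, ha⟩
    · simp only [cell, if_neg hx] at ha
      exact absurd ha (notMem_empty a)
  have hkey : ∀ x x' : I, ∀ a, a ∈ (x.1 : Set (Fin d → ℝ)) → a ∈ (x'.1 : Set (Fin d → ℝ)) →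
      val x a = val x' a → x = x' := by
    rintro ⟨⟨C, hC⟩, j⟩ ⟨⟨C', hC'⟩, j'⟩ a ha ha' hv
    obtain rfl : C = C' := huniq C hC C' hC' a ha ha'
    obtain rfl : j = j' := (hmono C hC a ha).injective hv
    rfl
  let e := Fintype.equivFin I
  refine ⟨Fintype.card I, fun i => cell (e.symm i), fun i => val (e.symm i), fun i => ?_,
    fun i a ha => ?_, fun i i' hii' a ha => ?_, ?_⟩
  · by_cases hx : (e.symm i).2 ∈ G (e.symm i).1 (e.symm i).1.2
    · simp only [cell, if_pos hx]
      exact ⟨h𝒮.isSemialgebraic _ (e.symm i).1.2, hsa _ (e.symm i).1.2 _⟩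
    · simp only [cell, if_neg hx]
      exact ⟨isSemialgebraic_empty, isSemialgebraicFunOn_empty _⟩
  · obtain ⟨hx, ha'⟩ := hcell _ a ha
    exact hG _ (e.symm i).1.2 _ hx (snoc_mem_graphOver_iff.mpr ⟨ha', rfl⟩)
  · intro hv
    have h1 := (hcell _ a ha.1).2
    have h2 := (hcell _ a ha.2).2
    exact hii' (e.symm.injective (hkey _ _ a h1 h2 hv))
  · refine measure_mono_null (t := ⋃ C : 𝒮, {a | a ∈ (C : Set (Fin d → ℝ)) ∧ (B C C.2).Nonempty})
      ?_ (measure_iUnion_null fun C => ?_)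
    · rintro a ⟨t, ht, hnot⟩
      obtain ⟨C, ⟨hC, haC⟩, -⟩ := hpart.2 a
      have htfib : t ∈ {t : ℝ | (Fin.snoc a t : Fin (d + 1) → ℝ) ∈ σ} := ht
      rw [hfibre C hC a haC] at htfib
      simp only [mem_union, mem_iUnion, mem_singleton_iff, mem_setOf_eq, exists_prop] at htfib
      rcases htfib with ⟨j, hj, rfl⟩ | ⟨j, hj, -⟩
      · exfalso
        refine hnot (e ⟨⟨C, hC⟩, j⟩) ⟨?_, ?_⟩
        · simp only [cell, Equiv.symm_apply_apply, if_pos hj]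
          exact haC
        · simp only [val, Equiv.symm_apply_apply]
      · exact mem_iUnion.mpr ⟨⟨C, hC⟩, haC, j, hj⟩
    · by_cases hBC : (B C C.2).Nonempty
      · exact measure_mono_null (fun a ha => ha.1) (hnull C C.2 hBC)
      · convert measure_empty (μ := (volume : Measure (Fin d → ℝ))) using 2
        ext a
        simp only [mem_setOf_eq, mem_empty_iff_false, iff_false, not_and]
        exact fun _ => hBC

/-! ## Finiteness of the set of fat horizontal slices -/

/-- For a `ℚ`-semialgebraic `W ⊆ ℝⁿ⁺¹`, the set of heights `τ` (as points of `ℝ¹`) whose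
horizontal slice `{w | (w, τ) ∈ W}` has non-empty interior is `ℚ`-semialgebraic: it is
`{τ | ∃ x r, r > 0 ∧ ∀ y, ∑ (yⱼ - xⱼ)² < r → (y, τ) ∈ W}`, two Tarski–Seidenberg projections
(`IsSemialgebraic.image_castAdd`) around one complement, as for `isSemialgebraic_interior`.
[folklore] -/
theorem isSemialgebraic_setOf_interior_slice_nonempty {n : ℕ} {W : Set (Fin (n + 1) → ℝ)}
    (hW : IsSemialgebraic ℚ W) :
    IsSemialgebraic ℚ {τ' : Fin 1 → ℝ |
      (interior {w : Fin n → ℝ | (Fin.snoc w (τ' 0) : Fin (n + 1) → ℝ) ∈ W}).Nonempty} := by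
  classical
  -- coordinates of `u ∈ ℝ ^ ((1 + (n + 1)) + n)`: `τ = u₀`, `x = u_{1..n}`, `r = u_{n+1}`, `y` last
  set ρ : Fin (n + 1) → Fin (1 + (n + 1) + n) :=
    Fin.snoc (fun j : Fin n => Fin.natAdd (1 + (n + 1)) j)
      (Fin.castAdd n (Fin.castAdd (n + 1) (0 : Fin 1))) with hρ
  have hρu : ∀ u : Fin (1 + (n + 1) + n) → ℝ, u ∘ ρ =
      Fin.snoc (fun j : Fin n => u (Fin.natAdd (1 + (n + 1)) j))
        (u (Fin.castAdd n (Fin.castAdd (n + 1) (0 : Fin 1)))) := by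
    intro u
    funext i
    refine Fin.lastCases ?_ (fun j => ?_) i
    · simp [hρ]
    · simp [hρ]
  set E : Set (Fin (1 + (n + 1) + n) → ℝ) :=
    {u | u ∘ ρ ∉ W ∧
      ∑ j : Fin n, (u (Fin.natAdd (1 + (n + 1)) j) -
        u (Fin.castAdd n (Fin.natAdd 1 (Fin.castSucc j)))) ^ 2 <
        u (Fin.castAdd n (Fin.natAdd 1 (Fin.last n)))} with hE
  have hB : IsSemialgebraic ℚ {u : Fin (1 + (n + 1) + n) → ℝ |
      ∑ j : Fin n, (u (Fin.natAdd (1 + (n + 1)) j) -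
        u (Fin.castAdd n (Fin.natAdd 1 (Fin.castSucc j)))) ^ 2 <
        u (Fin.castAdd n (Fin.natAdd 1 (Fin.last n)))} := by
    have := isSemialgebraic_setOf_eval_lt (k := ℚ) (R := ℝ)
      (∑ j : Fin n, (X (Fin.natAdd (1 + (n + 1)) j) -
        X (Fin.castAdd n (Fin.natAdd 1 (Fin.castSucc j)))) ^ 2 :
        MvPolynomial (Fin (1 + (n + 1) + n)) ℚ) (X (Fin.castAdd n (Fin.natAdd 1 (Fin.last n))))
    simpa using this
  have hEsa : IsSemialgebraic ℚ E := (hW.preimage_comp ρ).compl.inter hB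
  have hF := hEsa.image_castAdd
  have hG : IsSemialgebraic ℚ ({v : Fin (1 + (n + 1)) → ℝ | 0 < v (Fin.natAdd 1 (Fin.last n))} \
      (fun u : Fin (1 + (n + 1) + n) → ℝ => fun i : Fin (1 + (n + 1)) => u (Fin.castAdd n i)) '' E) := by
    refine IsSemialgebraic.diff ?_ hF
    simpa using isSemialgebraic_setOf_eval_pos (k := ℚ) (R := ℝ)
      (X (Fin.natAdd 1 (Fin.last n)) : MvPolynomial (Fin (1 + (n + 1))) ℚ)
  convert hG.image_castAdd using 1
  ext τ'
  simp only [mem_setOf_eq, mem_image, mem_sdiff]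
  constructor
  · rintro ⟨x, hx⟩
    rw [mem_interior_iff_exists_sum_sq_lt] at hx
    obtain ⟨r, hr, hball⟩ := hx
    refine ⟨Fin.append τ' (Fin.snoc x r : Fin (n + 1) → ℝ), ⟨?_, ?_⟩, funext fun i => by simp⟩
    · rw [Fin.append_right, Fin.snoc_last]
      exact hr
    rintro ⟨u, ⟨huW, hu⟩, huv⟩
    have hτ : u (Fin.castAdd n (Fin.castAdd (n + 1) (0 : Fin 1))) = τ' 0 := by
      simpa using congr_fun huv (Fin.castAdd (n + 1) (0 : Fin 1))
    have hx : ∀ j : Fin n, u (Fin.castAdd n (Fin.natAdd 1 (Fin.castSucc j))) = x j := fun j => by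
      simpa using congr_fun huv (Fin.natAdd 1 (Fin.castSucc j))
    have hr' : u (Fin.castAdd n (Fin.natAdd 1 (Fin.last n))) = r := by
      have := congr_fun huv (Fin.natAdd 1 (Fin.last n))
      simp only [Fin.append_right, Fin.snoc_last] at this
      exact this
    apply huW
    rw [hρu, hτ]
    refine hball _ ?_
    simpa only [hx, hr'] using hu
  · rintro ⟨v, ⟨hvr, hvF⟩, rfl⟩
    refine ⟨fun j => v (Fin.natAdd 1 (Fin.castSucc j)), ?_⟩
    rw [mem_interior_iff_exists_sum_sq_lt]
    refine ⟨v (Fin.natAdd 1 (Fin.last n)), hvr, fun y hy => ?_⟩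
    by_contra hyW
    apply hvF
    refine ⟨Fin.append v y, ⟨?_, ?_⟩, funext fun i => by simp⟩
    · rw [hρu]
      simpa using hyW
    · simpa using hy

/-- The zero set in `ℝ¹` of a polynomial over `ℚ` in one variable which does not vanish
identically on `ℝ¹` is finite (finitely many roots of a non-zero real polynomial). [folklore] -/
theorem finite_setOf_aeval_eq_zero_fin_one (q : MvPolynomial (Fin 1) ℚ)
    (hq : ∃ x : Fin 1 → ℝ, aeval x q ≠ 0) :
    {x : Fin 1 → ℝ | aeval x q = 0}.Finite := by
  obtain ⟨x₀, hx₀⟩ := hq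
  set p : Polynomial ℝ := aeval (fun _ : Fin 1 => (Polynomial.X : Polynomial ℝ)) q with hp
  have key : ∀ x : Fin 1 → ℝ, Polynomial.eval (x 0) p = aeval x q := by
    intro x
    have h1 : Polynomial.eval (x 0) p = ((Polynomial.aeval (x 0)).restrictScalars ℚ) p := by
      simp
    rw [h1, hp, MvPolynomial.comp_aeval_apply]
    have hx : (fun i : Fin 1 => (AlgHom.restrictScalars ℚ (Polynomial.aeval (x 0)))
        (Polynomial.X : Polynomial ℝ)) = x := by
      funext i
      rw [Subsingleton.elim i 0]
      simp
    rw [hx]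
  have hp0 : p ≠ 0 := fun h => hx₀ (by rw [← key, h, Polynomial.eval_zero])
  have hfin := Polynomial.finite_setOf_isRoot hp0
  have hset : {x : Fin 1 → ℝ | aeval x q = 0} = (fun x : Fin 1 → ℝ => x 0) ⁻¹' {r : ℝ | p.IsRoot r} := by
    ext x
    simp only [mem_setOf_eq, mem_preimage, Polynomial.IsRoot.def, key]
  rw [hset]
  refine hfin.preimage fun x _ y _ hxy => funext fun i => ?_
  rw [Subsingleton.elim i 0]
  exact hxy

/-- A `ℚ`-semialgebraic subset of `ℝ¹` with empty interior is finite: it is contained in finitely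
many zero sets of non-trivial univariate polynomials (`IsSemialgebraic.subset_interior_union`).
[folklore] -/
theorem finite_of_isSemialgebraic_of_interior_eq_empty {T : Set (Fin 1 → ℝ)}
    (hT : IsSemialgebraic ℚ T) (hint : interior T = ∅) : T.Finite := by
  obtain ⟨Q₀, hQ₀, hsub⟩ := hT.subset_interior_union
  rw [hint, empty_union] at hsub
  exact (Q₀.finite_toSet.biUnion fun q hq =>
    finite_setOf_aeval_eq_zero_fin_one q (hQ₀ q hq)).subset hsub

/-- **Finiteness of the fat levels.** If `W ⊆ ℝⁿ⁺¹` is `ℚ`-semialgebraic and its horizontal slices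
`W_τ = {w | (w, τ) ∈ W}` (`τ ∈ ℝ`) are pairwise disjoint, then only finitely many slices have
non-empty interior: the set of such `τ` is countable (pairwise disjoint subsets of `ℝⁿ` with
non-empty interior) and `ℚ`-semialgebraic (`isSemialgebraic_setOf_interior_slice_nonempty`), so it
has empty interior (a countable set is Lebesgue-null) and is finite
(`finite_of_isSemialgebraic_of_interior_eq_empty`). [folklore] -/
theorem finite_setOf_fat_level {n : ℕ} {W : Set (Fin (n + 1) → ℝ)} (hW : IsSemialgebraic ℚ W)
    (hdisj : ∀ (w : Fin n → ℝ) (τ τ' : ℝ), (Fin.snoc w τ : Fin (n + 1) → ℝ) ∈ W →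
      (Fin.snoc w τ' : Fin (n + 1) → ℝ) ∈ W → τ = τ') :
    {τ : ℝ | (interior {w : Fin n → ℝ | (Fin.snoc w τ : Fin (n + 1) → ℝ) ∈ W}).Nonempty}.Finite := by
  have hcount : {τ : ℝ | (interior {w : Fin n → ℝ |
      (Fin.snoc w τ : Fin (n + 1) → ℝ) ∈ W}).Nonempty}.Countable := by
    refine Set.PairwiseDisjoint.countable_of_nonempty_interior
      (s := fun τ : ℝ => {w : Fin n → ℝ | (Fin.snoc w τ : Fin (n + 1) → ℝ) ∈ W}) ?_ fun τ hτ => hτ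
    intro τ _ τ' _ hne
    rw [Function.onFun, Set.disjoint_left]
    exact fun w hw hw' => hne (hdisj w τ τ' hw hw')
  set T₁ : Set (Fin 1 → ℝ) := {τ' : Fin 1 → ℝ |
    (interior {w : Fin n → ℝ | (Fin.snoc w (τ' 0) : Fin (n + 1) → ℝ) ∈ W}).Nonempty} with hT₁
  have hT₁sa : IsSemialgebraic ℚ T₁ := isSemialgebraic_setOf_interior_slice_nonempty hW
  have hT₁count : T₁.Countable := by
    refine hcount.preimage_of_injOn (f := fun τ' : Fin 1 → ℝ => τ' 0) fun x _ y _ hxy => ?_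
    funext i
    rw [Subsingleton.elim i 0]
    exact hxy
  have hT₁int : interior T₁ = ∅ := by
    by_contra h
    have hne : (interior T₁).Nonempty := nonempty_iff_ne_empty.mpr h
    have hpos := isOpen_interior.measure_pos (volume : Measure (Fin 1 → ℝ)) hne
    have hzero : volume T₁ = 0 := hT₁count.measure_zero volume
    exact (lt_irrefl (0 : ENNReal))
      (hpos.trans_le ((measure_mono interior_subset).trans hzero.le))
  have hT₁fin : T₁.Finite := finite_of_isSemialgebraic_of_interior_eq_empty hT₁sa hT₁int
  exact (hT₁fin.image fun τ' : Fin 1 → ℝ => τ' 0).subset fun τ hτ => ⟨fun _ => τ, hτ, rfl⟩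

end PencilSheets

end Summit.KontsevichZagierPeriods.KontsevichZagierPeriods.BetaCancellationDivisorSlicing
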